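import Summits.BirchSwinnertonDyer.BirchSwinnertonDyer.Theorems.KolyvaginRankRigidityAtTwoKolyvaginCorankLowerBoundAtTwoThetaGlobalOrderLevelUp
import Summits.BirchSwinnertonDyer.BirchSwinnertonDyer.Theorems.KolyvaginRankRigidityAtTwoKolyvaginCorankLowerBoundAtTwoSelmerAwayFromConductor
import Summits.BirchSwinnertonDyer.BirchSwinnertonDyer.Theorems.KolyvaginRankRigidityAtTwoOffHabitatIrredClassesIntoSelmer
import Summits.BirchSwinnertonDyer.BirchSwinnertonDyer.Theorems.KolyvaginRankRigidityAtTwoOffHabitatIrredKolyvaginRelationAtTwo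
import HarnessLib

/-!
# Route `KolyvaginRankRigidityAtTwo`, residual crux R_irr `OffHabitatIrredNonSurjTwoConverse`
# (stmt-BirchSwinnertonDyer-27123, LINE 8∞): the LEVEL LINKS of the engine OFF THE HABITAT — global order
# up / down one level, `ι_*` injective, Selmer condition away from the conductor
# (helper, PROVED, unconditional; width seat `bsd-line-krr2-p2` g9)

Four small engine inputs whose habitat versions carry the binder `(∀ m, ρ̄_{E,2^m} onto)` but use the image only
through `E(K)[2] = 0` (Kummer / `ι_*` injectivity) and the `hA` binder `E(K[n])[2^M] = 0`:

* `torsionH1OfDvd_two_pow_injective_offHabitat` — `ι_* : H¹(K, E[2^M]) → H¹(K, E[2^{M'}])` injective from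
  `E(ℚ)[2] = 0` (`torsionPowToPrimaryH1_two_injective_offHabitat`, p649761);
* `globalOrderLevelUpAtTwo_offHabitat` — the text of the habitat stub `stub_globalOrderLevelUpAtTwo`
  (`2^j c_M(n) ≠ 0 ⇒ 2^{j+(M'-M)} c_{M'}(n) ≠ 0`) with the binder replaced by `E(ℚ)[2] = 0`;
* `globalOrderLevelDownAtTwo_offHabitat` — `2^{j+1} c_{M+1}(n) ≠ 0 ⇒ 2^j c_M(n) ≠ 0` (U2's «one level down»);
* `selmerAwayFromConductor_offHabitat` — the text of the habitat stub `stub_selmerAwayFromConductor`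
  (`2^t c_M(n)` is Selmer away from `n`) with the binder replaced — its proof never used the image.
The `hA` binder comes from `GenusExact.isAdmissible_pointsSubgroup_two_of_torsionBy_eq_bot` (p650518).

HONEST FRAMING: helper lemmas (`--supports` 27123) for the re-threading of V2irr / U2irr (LINE 8∞); nothing here
closes R_irr; BSD is NOT proved by any of this.

References: [McCallumLMS1991] §4 (4)–(6), Lemma 4.6; [GrossLMS1991] §4 (4.4), (4.6), Lemma 4.3;
[WZhang2014] p. 248; [SilvermanAEC2009] VII.
-/

set_option autoImplicit false
-- the Theorems namespace of this sub repeats the summit name by design (D-0017 nested layout)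
set_option linter.dupNamespace false

noncomputable section

open scoped Classical

open WeierstrassCurve Field Literature.NumberTheory.EllipticCurves
  Literature.NumberTheory.EllipticCurves.ModularForms NumberField IsDedekindDomain
  Literature.NumberTheory.EllipticCurves.KolyvaginCocycle
  Literature.NumberTheory.GaloisRepresentations

namespace Summit.BirchSwinnertonDyer.BirchSwinnertonDyer.Theorems.KolyvaginLowerBoundAtTwo

/-- **`ι_* : H¹(K, E[2^M]) → H¹(K, E[2^{M'}])` is injective off the habitat** (`E(ℚ)[2] = 0`, `K`
imaginary quadratic): followed by `H¹(K, E[2^{M'}]) → H¹(K, E[2^∞])` it is the injective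
`H¹(K, E[2^M]) → H¹(K, E[2^∞])` (`torsionPowToPrimaryH1_two_injective_offHabitat`). [cite: WZhang2014, p. 248] -/
theorem torsionH1OfDvd_two_pow_injective_offHabitat (W : WeierstrassCurve ℚ) [W.IsElliptic] {K : Type}
    [Field K] [NumberField K] (htorQ : AddSubgroup.torsionBy W.toAffine.Point (2 : ℤ) = ⊥)
    (hK : IsImaginaryQuadratic K) {M M' : ℕ} (h : ((2 ^ M : ℕ) : ℤ) ∣ ((2 ^ M' : ℕ) : ℤ)) :
    Function.Injective (torsionH1OfDvd (W.baseChange K) h) := by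
  intro x y hxy
  apply KolyvaginRankRigidity.torsionPowToPrimaryH1_two_injective_offHabitat W htorQ hK M
  rw [← torsionPowToPrimaryH1_comp_torsionH1OfDvd (W.baseChange K) h, AddMonoidHom.comp_apply,
    AddMonoidHom.comp_apply, hxy]

/-- **Global orders go UP with the level, off the habitat** — the text of the habitat stub
`stub_globalOrderLevelUpAtTwo` with `(∀ m, ρ̄_{E,2^m} onto)` replaced by `E(ℚ)[2] = 0`:
`2^j c_M(n) ≠ 0 ⇒ 2^{j+(M'-M)} c_{M'}(n) ≠ 0` for `M ≤ M' ≤ M(n)`. [cite: McCallumLMS1991, §4 (4)–(6), Lemma 4.6]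
[cite: GrossLMS1991, §4 (4.4), (4.6)] -/
theorem globalOrderLevelUpAtTwo_offHabitat :
    ∀ (W : WeierstrassCurve ℚ) [W.IsElliptic] [W.IsGloballyMinimal], ¬ W.HasCM →
      (Rank1Residual.GoodOrd W 2 ∨ Rank1Residual.Mult W 2) →
      AddSubgroup.torsionBy W.toAffine.Point (2 : ℤ) = ⊥ →
      ∀ (K : Type) [Field K] [NumberField K], IsImaginaryQuadratic K → NumberField.discr K ≠ -3 →
      NumberField.discr K ≠ -4 → ¬ ((2 : ℤ) ∣ NumberField.discr K) → ∀ [NeZero (W.conductorNorm ℤ)],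
      SatisfiesHeegnerHypothesis (W.conductorNorm ℤ) K →
      ∀ (Dt : ModularParametrizationData W (W.conductorNorm ℤ)) (β : ℤ) (ι : K →+* ℂ),
        ∀ (n : ℕ) (dat : KolyvaginHeegnerData Dt β ι n) (M M' j : ℕ),
          KolyvaginDescent.KolSupp (Zhang2014.IsKolyvaginPrime (W.conductorNorm ℤ) W K 2) n →
          1 ≤ M → M ≤ M' → (M' : ℕ∞) ≤ Zhang2014.levelIndex W 2 n →
          ((2 ^ j : ℕ) : ℤ) • dat.kolyvaginClass Nat.prime_two M ≠ 0 →
          ((2 ^ (j + (M' - M)) : ℕ) : ℤ) • dat.kolyvaginClass Nat.prime_two M' ≠ 0 := by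
  intro W _ _ _ _ htorQ K _ _ hK hne3 hne4 _ _ hHN Dt β ι n dat M M' j hn _ hMM' hlev hne
  have hD : NumberField.discr K < -4 :=
    Summit.BirchSwinnertonDyer.Rank1Residual.X11b.KolyvaginAssembly.discr_lt_neg_four hK ⟨hne3, hne4⟩
  have hn0 : n ≠ 0 := hn.1.ne_zero
  -- the class at level `M` is McCallum's class (it is non-zero)
  have hne0 : dat.kolyvaginClass Nat.prime_two M ≠ 0 := fun h ↦ hne (by rw [h, zsmul_zero])
  obtain ⟨hA, hP⟩ := dat.kolyvaginClass_ne_zero hne0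
  -- the standing inputs at level `M'` OFF the habitat
  have hA' : IsAdmissible (absoluteGaloisGroup K) dat.pointsSubgroup ((2 ^ M' : ℕ) : ℤ) :=
    GenusExact.isAdmissible_pointsSubgroup_two_of_torsionBy_eq_bot dat htorQ hK hn0 hne4 hHN M'
  have hkol : ∀ q ∈ n.primeFactors, Zhang2014.IsKolyvaginPrime (W.conductorNorm ℤ) W K 2 q ∧
      M' ≤ Zhang2014.kolyvaginIndex W 2 q :=
    fun q hq ↦ ⟨hn.2 q hq, (Zhang2014.natCast_le_levelIndex_iff.mp hlev) q hq⟩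
  have hP' : dat.toGeomPoints dat.derivedPoint ∈
      invPoints (absoluteGaloisGroup K) dat.pointsSubgroup ((2 ^ M' : ℕ) : ℤ) :=
    Prop44.toGeomPoints_derivedPoint_mem_invPoints hK ι hD hHN Dt Nat.prime_two hn.1 hkol dat
  -- `ι_* (2^j c_M) = 2^j 2^{M'-M} c_{M'}`, and `ι_*` is injective
  have hdvd : ((2 ^ M : ℕ) : ℤ) ∣ ((2 ^ M' : ℕ) : ℤ) := by exact_mod_cast pow_dvd_pow 2 hMM'
  have hinj := torsionH1OfDvd_two_pow_injective_offHabitat W htorQ hK hdvd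
  intro h0
  apply hne
  apply hinj
  rw [map_zero, map_zsmul, torsionH1OfDvd_kolyvaginClass_two_pow dat hMM' hA hP hA' hP', smul_smul,
    ← Nat.cast_mul, ← pow_add]
  exact h0

/-- **`2^{j+1} c_{M+1}(n) ≠ 0 ⇒ 2^j c_M(n) ≠ 0` off the habitat** (U2's «one level down», `M + 1 ≤ M(n)`;
the level link `ι_* c_M(n) = 2 c_{M+1}(n)` read downwards, admissibility at level `M` from `E(ℚ)[2] = 0`).
[cite: McCallumLMS1991, §4 (4)–(6), Lemma 4.6] -/
theorem globalOrderLevelDownAtTwo_offHabitat (W : WeierstrassCurve ℚ) [W.IsElliptic] [W.IsGloballyMinimal]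
    (htorQ : AddSubgroup.torsionBy W.toAffine.Point (2 : ℤ) = ⊥)
    (K : Type) [Field K] [NumberField K] (hK : IsImaginaryQuadratic K) (hne3 : NumberField.discr K ≠ -3)
    (hne4 : NumberField.discr K ≠ -4) [NeZero (W.conductorNorm ℤ)]
    (hHN : SatisfiesHeegnerHypothesis (W.conductorNorm ℤ) K)
    (Dt : ModularParametrizationData W (W.conductorNorm ℤ)) (β : ℤ) (ι : K →+* ℂ)
    (n : ℕ) (dat : KolyvaginHeegnerData Dt β ι n) (M j : ℕ)
    (hn : KolyvaginDescent.KolSupp (Zhang2014.IsKolyvaginPrime (W.conductorNorm ℤ) W K 2) n)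
    (hlev : ((M + 1 : ℕ) : ℕ∞) ≤ Zhang2014.levelIndex W 2 n)
    (hne : ((2 ^ (j + 1) : ℕ) : ℤ) • dat.kolyvaginClass Nat.prime_two (M + 1) ≠ 0) :
    ((2 ^ j : ℕ) : ℤ) • dat.kolyvaginClass Nat.prime_two M ≠ 0 := by
  have hD : NumberField.discr K < -4 :=
    Summit.BirchSwinnertonDyer.Rank1Residual.X11b.KolyvaginAssembly.discr_lt_neg_four hK ⟨hne3, hne4⟩
  have hn0 : n ≠ 0 := hn.1.ne_zero
  have hne0 : dat.kolyvaginClass Nat.prime_two (M + 1) ≠ 0 := fun h ↦ hne (by rw [h, zsmul_zero])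
  obtain ⟨hA', hP'⟩ := dat.kolyvaginClass_ne_zero hne0
  have hA : IsAdmissible (absoluteGaloisGroup K) dat.pointsSubgroup ((2 ^ M : ℕ) : ℤ) :=
    GenusExact.isAdmissible_pointsSubgroup_two_of_torsionBy_eq_bot dat htorQ hK hn0 hne4 hHN M
  have hkol : ∀ q ∈ n.primeFactors, Zhang2014.IsKolyvaginPrime (W.conductorNorm ℤ) W K 2 q ∧
      M ≤ Zhang2014.kolyvaginIndex W 2 q := fun q hq ↦
    ⟨hn.2 q hq, Nat.le_of_succ_le ((Zhang2014.natCast_le_levelIndex_iff.mp hlev) q hq)⟩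
  have hP : dat.toGeomPoints dat.derivedPoint ∈
      invPoints (absoluteGaloisGroup K) dat.pointsSubgroup ((2 ^ M : ℕ) : ℤ) :=
    Prop44.toGeomPoints_derivedPoint_mem_invPoints hK ι hD hHN Dt Nat.prime_two hn.1 hkol dat
  intro h0
  apply hne
  have h := congrArg (torsionH1OfDvd (W.baseChange K)
    (by exact_mod_cast pow_dvd_pow 2 (Nat.le_succ M) : ((2 ^ M : ℕ) : ℤ) ∣ ((2 ^ (M + 1) : ℕ) : ℤ))) h0
  rw [map_zero, map_zsmul, torsionH1OfDvd_kolyvaginClass_two_pow dat (Nat.le_succ M) hA hP hA' hP', smul_smul,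
    ← Nat.cast_mul, ← pow_add, show j + (M + 1 - M) = j + 1 by omega] at h
  exact h

/-- **Selmer condition away from the conductor, off the habitat** — the text of the habitat stub
`KolyvaginRankRigidity.stub_selmerAwayFromConductor` with the binder replaced by `E(ℚ)[2] = 0`: with
`t = |Δ_min| + 4`, `2^t c_M(n)` satisfies the Selmer local condition at every place not dividing `n` (the habitat
proof never used the image). [cite: GrossLMS1991, Prop. 6.2 (1)] [cite: McCallumLMS1991, §4] -/
theorem selmerAwayFromConductor_offHabitat :
    ∀ (W : WeierstrassCurve ℚ) [W.IsElliptic] [W.IsGloballyMinimal], ¬ W.HasCM →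
      (Rank1Residual.GoodOrd W 2 ∨ Rank1Residual.Mult W 2) →
      AddSubgroup.torsionBy W.toAffine.Point (2 : ℤ) = ⊥ →
      ∀ (K : Type) [Field K] [NumberField K], IsImaginaryQuadratic K → NumberField.discr K ≠ -3 →
        NumberField.discr K ≠ -4 → ¬ ((2 : ℤ) ∣ NumberField.discr K) → ∀ [NeZero (W.conductorNorm ℤ)],
        SatisfiesHeegnerHypothesis (W.conductorNorm ℤ) K →
        ∀ (Dt : ModularParametrizationData W (W.conductorNorm ℤ)) (β : ℤ) (ι : K →+* ℂ),
          ∃ t : ℕ, ∀ (n : ℕ) (d : KolyvaginHeegnerData Dt β ι n) (M : ℕ),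
            KolyvaginDescent.KolSupp (Zhang2014.IsKolyvaginPrime (W.conductorNorm ℤ) W K 2) n →
            1 ≤ M → (M : ℕ∞) ≤ Zhang2014.levelIndex W 2 n →
            ∀ v : HeightOneSpectrum (𝓞 K), ((n : ℕ) : 𝓞 K) ∉ v.asIdeal →
              ((2 ^ t : ℕ) : ℤ) • d.kolyvaginClass Nat.prime_two M ∈
                selmerLocalKer (W.baseChange K) (v.adicCompletion K) ((2 ^ M : ℕ) : ℤ) := by
  intro W _ _ _ _ _ K _ _ hK _ _ _ _ hH Dt β ι
  exact ⟨(minimalDiscriminantInt W).natAbs + 4, fun n d M hn _ _ v hv ↦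
    KolyvaginRankRigidity.pow_zsmul_kolyvaginClass_two_mem_selmerLocalKer W hK hH hn.1.ne_zero d M v hv⟩

end Summit.BirchSwinnertonDyer.BirchSwinnertonDyer.Theorems.KolyvaginLowerBoundAtTwo

end
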